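import Summits.HodgeConjecture.HodgeCM.Prior.Faces_1

/-! PORT of `HodgeCM/Prior/Faces.lean` (HodgeCMPerL run 81) — part 2: continuation of `Summits.HodgeConjecture.HodgeCM.Prior.Faces_1` (split at a top-level declaration boundary by port_pkg.py; scope re-opened below; declarations unchanged). -/

-- port_pkg: scope re-opened for this part (file-level context, then the namespace/section stack open at the cut)
namespace HodgeCM.Prior.Faces
namespace Perl34
variable {X : Type*} [DecidableEq X]
section faces

variable {X : Type*} [DecidableEq X] {ι : X → X} {Φ : Finset X} {t t' : X}

/-- Corner `Φ₂ = Φ̄^{(π)}` of the face `(Φ; π, π')` (rfwf l.56). `Φ₁` is `Φ` itself. -/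
def corner2 (ι : X → X) (t : X) (Φ : Finset X) : Finset X := flipP ι t (conjS ι Φ)

/-- Corner `Φ₃ = Φ̄^{(π')}` (rfwf l.56). -/
def corner3 (ι : X → X) (t' : X) (Φ : Finset X) : Finset X := flipP ι t' (conjS ι Φ)

/-- Corner `Φ₄ = Φ^{(ππ')}` (rfwf l.56). -/
def corner4 (ι : X → X) (t t' : X) (Φ : Finset X) : Finset X := flipP ι t (flipP ι t' Φ)

/-- (no docstring in the 2001 source) -/
lemma self_mem_orbS : t ∈ orbS ι t := mem_orbS.mpr (Or.inl rfl)

/-- (no docstring in the 2001 source) -/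
lemma iota_mem_orb_iff (hι : ∀ x, ι (ι x) = x) {x : X} :
    ι x ∈ orbS ι t ↔ x ∈ orbS ι t := by
  rw [mem_orbS, mem_orbS]
  constructor
  · rintro (h | h)
    · right; rw [← h, hι]
    · left
      have := congrArg ι h
      rwa [hι, hι] at this
  · rintro (rfl | rfl)
    · right; rfl
    · left; exact hι t

/-- "Two distinct places" is symmetric. -/
lemma not_mem_orb_symm (hι : ∀ x, ι (ι x) = x) (h : t' ∉ orbS ι t) : t ∉ orbS ι t' := by
  rw [mem_orbS] at h ⊢
  push Not at h ⊢
  refine ⟨fun he => h.1 he.symm, fun he => h.2 ?_⟩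
  rw [he, hι]

/-- Distinct places have disjoint orbits. -/
lemma not_mem_orb_of_mem_orb (hι : ∀ x, ι (ι x) = x) (h : t' ∉ orbS ι t) {x : X}
    (hx : x ∈ orbS ι t) : x ∉ orbS ι t' := by
  intro hx'
  rcases mem_orbS.mp hx' with rfl | he
  · exact h hx
  · rw [he] at hx
    exact h ((iota_mem_orb_iff hι).mp hx)

/-- Membership in the corners, by block (rfwf proof of l:hodge, ll.66-68):
at the place of `t`, `Φ₁, Φ₂` carry the element of `Φ` and `Φ₃, Φ₄` its conjugate. -/
lemma mem_corner2_of_orb (hι : ∀ x, ι (ι x) = x) (hΦ : IsCMS ι Φ) {x : X}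
    (hx : x ∈ orbS ι t) : x ∈ corner2 ι t Φ ↔ x ∈ Φ := by
  unfold corner2
  rw [mem_flipP_of_orb hx, mem_conjS hι, hΦ.iota_mem_iff]
  exact not_not

/-- (no docstring in the 2001 source) -/
lemma mem_corner2_of_not_orb (hι : ∀ x, ι (ι x) = x) (hΦ : IsCMS ι Φ) {x : X}
    (hx : x ∉ orbS ι t) : x ∈ corner2 ι t Φ ↔ x ∉ Φ := by
  unfold corner2
  rw [mem_flipP_of_not_orb hx, mem_conjS hι, hΦ.iota_mem_iff]

/-- (no docstring in the 2001 source) -/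
lemma mem_corner3_of_orb (hι : ∀ x, ι (ι x) = x) (hΦ : IsCMS ι Φ) {x : X}
    (hx : x ∈ orbS ι t') : x ∈ corner3 ι t' Φ ↔ x ∈ Φ :=
  mem_corner2_of_orb hι hΦ hx

/-- (no docstring in the 2001 source) -/
lemma mem_corner3_of_not_orb (hι : ∀ x, ι (ι x) = x) (hΦ : IsCMS ι Φ) {x : X}
    (hx : x ∉ orbS ι t') : x ∈ corner3 ι t' Φ ↔ x ∉ Φ :=
  mem_corner2_of_not_orb hι hΦ hx

/-- (no docstring in the 2001 source) -/
lemma mem_corner4_of_orb_left (hι : ∀ x, ι (ι x) = x) (hd : t' ∉ orbS ι t) {x : X}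
    (hx : x ∈ orbS ι t) : x ∈ corner4 ι t t' Φ ↔ x ∉ Φ := by
  unfold corner4
  rw [mem_flipP_of_orb hx, mem_flipP_of_not_orb (not_mem_orb_of_mem_orb hι hd hx)]

/-- (no docstring in the 2001 source) -/
lemma mem_corner4_of_orb_right (hι : ∀ x, ι (ι x) = x) (hd : t' ∉ orbS ι t) {x : X}
    (hx : x ∈ orbS ι t') : x ∈ corner4 ι t t' Φ ↔ x ∉ Φ := by
  unfold corner4
  have hxt : x ∉ orbS ι t := fun hc => (not_mem_orb_of_mem_orb hι hd hc) hx
  rw [mem_flipP_of_not_orb hxt, mem_flipP_of_orb hx]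

/-- (no docstring in the 2001 source) -/
lemma mem_corner4_of_not_orb {x : X} (hx : x ∉ orbS ι t) (hx' : x ∉ orbS ι t') :
    x ∈ corner4 ι t t' Φ ↔ x ∈ Φ := by
  unfold corner4
  rw [mem_flipP_of_not_orb hx, mem_flipP_of_not_orb hx']

/-- The corners of a face are CM types. -/
lemma isCMS_corner2 (hι : ∀ x, ι (ι x) = x) (hΦ : IsCMS ι Φ) :
    IsCMS ι (corner2 ι t Φ) := (hΦ.conjS hι).flipP hι t

/-- (no docstring in the 2001 source) -/
lemma isCMS_corner3 (hι : ∀ x, ι (ι x) = x) (hΦ : IsCMS ι Φ) :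
    IsCMS ι (corner3 ι t' Φ) := (hΦ.conjS hι).flipP hι t'

/-- (no docstring in the 2001 source) -/
lemma isCMS_corner4 (hι : ∀ x, ι (ι x) = x) (hΦ : IsCMS ι Φ) :
    IsCMS ι (corner4 ι t t' Φ) := (hΦ.flipP hι t').flipP hι t

/-- Lemma l:hodge, indicator form: `Σᵢ 1_{Φᵢ} = 2` as functions on `X`
(rfwf ll.60-68; "every x ∈ G lies in exactly two corners"). -/
theorem l_hodge (hι : ∀ x, ι (ι x) = x) (hΦ : IsCMS ι Φ) (hd : t' ∉ orbS ι t) (x : X) :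
    indX Φ x + indX (corner2 ι t Φ) x + indX (corner3 ι t' Φ) x
      + indX (corner4 ι t t' Φ) x = 2 := by
  by_cases h1 : x ∈ orbS ι t
  · have h2 : x ∉ orbS ι t' := not_mem_orb_of_mem_orb hι hd h1
    have e2 := mem_corner2_of_orb (Φ := Φ) hι hΦ h1
    have e3 := mem_corner3_of_not_orb (Φ := Φ) hι hΦ h2
    have e4 := mem_corner4_of_orb_left (Φ := Φ) hι hd h1
    by_cases hm : x ∈ Φ
    · have i1 := indX_of_mem hm
      have i2 := indX_of_mem (e2.mpr hm)
      have i3 := indX_of_not_mem (fun hc => (e3.mp hc) hm)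
      have i4 := indX_of_not_mem (fun hc => (e4.mp hc) hm)
      omega
    · have i1 := indX_of_not_mem hm
      have i2 := indX_of_not_mem (fun hc => hm (e2.mp hc))
      have i3 := indX_of_mem (e3.mpr hm)
      have i4 := indX_of_mem (e4.mpr hm)
      omega
  · by_cases h2 : x ∈ orbS ι t'
    · have e2 := mem_corner2_of_not_orb (Φ := Φ) hι hΦ h1
      have e3 := mem_corner3_of_orb (Φ := Φ) hι hΦ h2
      have e4 := mem_corner4_of_orb_right (Φ := Φ) hι hd h2
      by_cases hm : x ∈ Φ
      · have i1 := indX_of_mem hm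
        have i2 := indX_of_not_mem (fun hc => (e2.mp hc) hm)
        have i3 := indX_of_mem (e3.mpr hm)
        have i4 := indX_of_not_mem (fun hc => (e4.mp hc) hm)
        omega
      · have i1 := indX_of_not_mem hm
        have i2 := indX_of_mem (e2.mpr hm)
        have i3 := indX_of_not_mem (fun hc => hm (e3.mp hc))
        have i4 := indX_of_mem (e4.mpr hm)
        omega
    · have e2 := mem_corner2_of_not_orb (Φ := Φ) hι hΦ h1
      have e3 := mem_corner3_of_not_orb (Φ := Φ) hι hΦ h2
      have e4 := mem_corner4_of_not_orb (Φ := Φ) h1 h2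
      by_cases hm : x ∈ Φ
      · have i1 := indX_of_mem hm
        have i2 := indX_of_not_mem (fun hc => (e2.mp hc) hm)
        have i3 := indX_of_not_mem (fun hc => (e3.mp hc) hm)
        have i4 := indX_of_mem (e4.mpr hm)
        omega
      · have i1 := indX_of_not_mem hm
        have i2 := indX_of_mem (e2.mpr hm)
        have i3 := indX_of_mem (e3.mpr hm)
        have i4 := indX_of_not_mem (fun hc => hm (e4.mp hc))
        omega

end faces

/-! ## Distinctness of corners and the Θ-normalisation (rfwf ll.79-96) -/

section distinct

variable {X : Type*} [DecidableEq X] {ι : X → X} {Φ : Finset X} {t t' : X}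

omit [DecidableEq X] in
/-- Two finsets whose memberships at one point decide a proposition oppositely differ. -/
lemma ne_of_mem_iff {A B : Finset X} {x : X} {P : Prop} (hA : x ∈ A ↔ P)
    (hB : x ∈ B ↔ ¬P) : A ≠ B := by
  intro h
  rw [h] at hA
  have := hA.symm.trans hB
  tauto

/-- The four corners of a face are pairwise distinct types (rfwf l:tetra proof l.90:
"The corners are pairwise distinct types"). -/
theorem corners_pairwise_distinct (hι : ∀ x, ι (ι x) = x) (hΦ : IsCMS ι Φ)
    (hd : t' ∉ orbS ι t) :
    Φ ≠ corner2 ι t Φ ∧ Φ ≠ corner3 ι t' Φ ∧ Φ ≠ corner4 ι t t' Φ ∧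
    corner2 ι t Φ ≠ corner3 ι t' Φ ∧ corner2 ι t Φ ≠ corner4 ι t t' Φ ∧
    corner3 ι t' Φ ≠ corner4 ι t t' Φ := by
  have hd' : t ∉ orbS ι t' := not_mem_orb_symm hι hd
  refine ⟨?_, ?_, ?_, ?_, ?_, ?_⟩
  · exact ne_of_mem_iff (x := t') Iff.rfl (mem_corner2_of_not_orb hι hΦ hd)
  · exact ne_of_mem_iff (x := t) Iff.rfl (mem_corner3_of_not_orb hι hΦ hd')
  · exact ne_of_mem_iff (x := t) Iff.rfl (mem_corner4_of_orb_left hι hd self_mem_orbS)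
  · exact ne_of_mem_iff (x := t) (mem_corner2_of_orb hι hΦ self_mem_orbS)
      (mem_corner3_of_not_orb hι hΦ hd')
  · exact ne_of_mem_iff (x := t) (mem_corner2_of_orb hι hΦ self_mem_orbS)
      (mem_corner4_of_orb_left hι hd self_mem_orbS)
  · exact ne_of_mem_iff (x := t') (mem_corner3_of_orb hι hΦ self_mem_orbS)
      (mem_corner4_of_orb_right hι hd self_mem_orbS)

/-- Membership in a conjugated corner is corner membership at `ι x`. -/
lemma mem_conj_corner (hι : ∀ x, ι (ι x) = x) {A : Finset X} {x : X} :
    x ∈ conjS ι A ↔ ι x ∈ A := mem_conjS hι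

/-- No corner equals the conjugate of another corner, for the four non-diagonal pairs
(rfwf l:tetra proof ll.90-94: "Φᵢ = −Φⱼ is impossible for {1,2},{1,3},{2,4},{3,4}"). -/
theorem corners_ne_conj_nondiag (hι : ∀ x, ι (ι x) = x) (hΦ : IsCMS ι Φ)
    (hd : t' ∉ orbS ι t) :
    Φ ≠ conjS ι (corner2 ι t Φ) ∧ Φ ≠ conjS ι (corner3 ι t' Φ) ∧
    corner2 ι t Φ ≠ conjS ι (corner4 ι t t' Φ) ∧
    corner3 ι t' Φ ≠ conjS ι (corner4 ι t t' Φ) := by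
  have hd' : t ∉ orbS ι t' := not_mem_orb_symm hι hd
  have hιt : ι t ∈ orbS ι t := (iota_mem_orb_iff hι).mpr self_mem_orbS
  have hιt' : ι t' ∈ orbS ι t' := (iota_mem_orb_iff hι).mpr self_mem_orbS
  refine ⟨?_, ?_, ?_, ?_⟩
  · refine ne_of_mem_iff (x := t) Iff.rfl ?_
    rw [mem_conj_corner hι, mem_corner2_of_orb hι hΦ hιt]
    exact hΦ.iota_mem_iff
  · refine ne_of_mem_iff (x := t') Iff.rfl ?_
    rw [mem_conj_corner hι, mem_corner3_of_orb hι hΦ hιt']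
    exact hΦ.iota_mem_iff
  · refine ne_of_mem_iff (x := t') (mem_corner2_of_not_orb hι hΦ hd) ?_
    rw [mem_conj_corner hι, mem_corner4_of_orb_right hι hd hιt', hΦ.iota_mem_iff]
  · refine ne_of_mem_iff (x := t) (mem_corner3_of_not_orb hι hΦ hd') ?_
    rw [mem_conj_corner hι, mem_corner4_of_orb_left hι hd hιt, hΦ.iota_mem_iff]

/-- The diagonal pairs need a third place ("g ≥ 3"): with a point `u` outside both
orbits, `Φ₁ ≠ Φ̄₄` and `Φ₂ ≠ Φ̄₃` (rfwf l:tetra proof ll.92-94). -/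
theorem corners_ne_conj_diag (hι : ∀ x, ι (ι x) = x) (hΦ : IsCMS ι Φ)
    (_hd : t' ∉ orbS ι t) {u : X} (hu : u ∉ orbS ι t) (hu' : u ∉ orbS ι t') :
    Φ ≠ conjS ι (corner4 ι t t' Φ) ∧ corner2 ι t Φ ≠ conjS ι (corner3 ι t' Φ) := by
  have hιu : ι u ∉ orbS ι t := fun hc => hu ((iota_mem_orb_iff hι).mp hc)
  have hιu' : ι u ∉ orbS ι t' := fun hc => hu' ((iota_mem_orb_iff hι).mp hc)
  constructor
  · refine ne_of_mem_iff (x := u) Iff.rfl ?_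
    rw [mem_conj_corner hι, mem_corner4_of_not_orb hιu hιu']
    exact hΦ.iota_mem_iff
  · refine ne_of_mem_iff (x := u) (mem_corner2_of_not_orb hι hΦ hu) ?_
    rw [mem_conj_corner hι, mem_corner3_of_not_orb hι hΦ hιu', hΦ.iota_mem_iff]

/-- Converse: with NO third place (every point in one of the two orbits, "g = 2"),
`Φ₄ = Φ̄₁` (rfwf l:tetra proof ll.93-94: "forces v = ∅, g = 2"). -/
theorem corner4_eq_conj_of_no_third_place (hι : ∀ x, ι (ι x) = x) (hΦ : IsCMS ι Φ)
    (hd : t' ∉ orbS ι t) (hall : ∀ x : X, x ∈ orbS ι t ∨ x ∈ orbS ι t') :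
    corner4 ι t t' Φ = conjS ι Φ := by
  ext x
  rw [mem_conjS hι, hΦ.iota_mem_iff]
  rcases hall x with hx | hx
  · exact mem_corner4_of_orb_left hι hd hx
  · exact mem_corner4_of_orb_right hι hd hx

end distinct

/-! ## Θ-normalisation and the tetrahedron identity (rfwf eq:theta ll.79-84, l:tetra) -/

section theta

variable {X : Type*} [DecidableEq X] {ι : X → X} {Ψ₁ Ψ₂ Ψ₃ Ψ₄ : Finset X}

/-- Θ-normalisation turns the four-corner sum `Σᵢ 1_{Φᵢ} = 2` into the tetrahedron
identity: with the corners renumbered so that `Θᵢ := Φᵢ (i = 1,2)`, `Θᵢ := ιΦᵢ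
(i = 3,4)`, one has `1_{Θ₁}+1_{Θ₂} = 1_{Θ₃}+1_{Θ₄}` (rfwf l:tetra proof l.90:
`Σᵢ 1_{Φᵢ} = 2` and `1_{cΦ} = 1 − 1_Φ`). -/
theorem theta_pairSum (hι : ∀ x, ι (ι x) = x) (h₃ : IsCMS ι Ψ₃) (h₄ : IsCMS ι Ψ₄)
    (hsum : ∀ x, indX Ψ₁ x + indX Ψ₂ x + indX Ψ₃ x + indX Ψ₄ x = 2) :
    PairSum Ψ₁ Ψ₂ (conjS ι Ψ₃) (conjS ι Ψ₄) := by
  intro x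
  rw [indX_conjS hι h₃, indX_conjS hι h₄]
  have := hsum x
  omega

/-- All four Θᵢ contain the base point, once the two corners containing it are
numbered 1, 2 (rfwf ll.79-84: "four CM types containing 1"). This is hypothesis (H2)
of the plan's C6. -/
theorem theta_basepoint_mem (hι : ∀ x, ι (ι x) = x) (h₃ : IsCMS ι Ψ₃) (h₄ : IsCMS ι Ψ₄)
    {x₀ : X} (m1 : x₀ ∈ Ψ₁) (m2 : x₀ ∈ Ψ₂) (m3 : x₀ ∉ Ψ₃) (m4 : x₀ ∉ Ψ₄) :
    x₀ ∈ Ψ₁ ∧ x₀ ∈ Ψ₂ ∧ x₀ ∈ conjS ι Ψ₃ ∧ x₀ ∈ conjS ι Ψ₄ :=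
  ⟨m1, m2, (mem_conjS hι).mpr (h₃.iota_mem_iff.mpr m3),
    (mem_conjS hι).mpr (h₄.iota_mem_iff.mpr m4)⟩

/-- The Θ-quadruple keeps its four CM types CM. -/
theorem theta_isCMS (hι : ∀ x, ι (ι x) = x) (h₁ : IsCMS ι Ψ₁) (h₂ : IsCMS ι Ψ₂)
    (h₃ : IsCMS ι Ψ₃) (h₄ : IsCMS ι Ψ₄) :
    IsCMS ι Ψ₁ ∧ IsCMS ι Ψ₂ ∧ IsCMS ι (conjS ι Ψ₃) ∧ IsCMS ι (conjS ι Ψ₄) :=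
  ⟨h₁, h₂, h₃.conjS hι, h₄.conjS hι⟩

/-- Pairwise distinctness of the Θ-quadruple from corner distinctness and
cross-conjugate distinctness (rfwf l:tetra l.86: "If g ≥ 3 the four Θᵢ are pairwise
distinct"; the cross hypotheses are discharged for a face by
`corners_pairwise_distinct`, `corners_ne_conj_nondiag`, `corners_ne_conj_diag`). -/
theorem theta_pairwise_distinct (hι : ∀ x, ι (ι x) = x)
    (h12 : Ψ₁ ≠ Ψ₂) (h34 : Ψ₃ ≠ Ψ₄)
    (h13 : Ψ₁ ≠ conjS ι Ψ₃) (h14 : Ψ₁ ≠ conjS ι Ψ₄)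
    (h23 : Ψ₂ ≠ conjS ι Ψ₃) (h24 : Ψ₂ ≠ conjS ι Ψ₄) :
    Ψ₁ ≠ Ψ₂ ∧ Ψ₁ ≠ conjS ι Ψ₃ ∧ Ψ₁ ≠ conjS ι Ψ₄ ∧ Ψ₂ ≠ conjS ι Ψ₃ ∧
    Ψ₂ ≠ conjS ι Ψ₄ ∧ conjS ι Ψ₃ ≠ conjS ι Ψ₄ :=
  ⟨h12, h13, h14, h23, h24, fun h => h34 (conjS_injective hι h)⟩

end theta

/-! ## Sign-vector model: types as `Fin g → Bool` (plan A1), the g = 3 tetrahedron of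
PerL l.60, and the g = 2 collapse -/

section signVectors

/-- Embeddings of a CM field over a totally real field with `g` real places:
`(a, s)`, the two embeddings above place `a`. -/
abbrev Emb (g : ℕ) := Fin g × Bool

/-- Complex conjugation on embeddings. -/
def svIota (g : ℕ) : Emb g → Emb g := fun p => (p.1, !p.2)

/-- (no docstring in the 2001 source) -/
lemma svIota_invol (g : ℕ) : ∀ p : Emb g, svIota g (svIota g p) = p := by
  intro p
  simp [svIota]

/-- The CM type of a sign vector `t : Fin g → Bool` (`t a = true` iff the type
contains the embedding `(a, true)`; PerL ll.56-60, rfwf l.91 "writing types as sign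
vectors"). -/
def svType {g : ℕ} (t : Fin g → Bool) : Finset (Emb g) :=
  Finset.univ.filter (fun p => t p.1 = p.2)

/-- (no docstring in the 2001 source) -/
lemma mem_svType {g : ℕ} {t : Fin g → Bool} {p : Emb g} :
    p ∈ svType t ↔ t p.1 = p.2 := by simp [svType]

/-- (no docstring in the 2001 source) -/
lemma isCMS_svType {g : ℕ} (t : Fin g → Bool) : IsCMS (svIota g) (svType t) := by
  intro p
  rcases p with ⟨a, s⟩
  simp only [mem_svType, svIota]
  cases s <;> cases h : t a <;> simp

/-- Sign vectors inject into types. -/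
lemma svType_injective {g : ℕ} {t t' : Fin g → Bool} (h : svType t = svType t') :
    t = t' := by
  funext a
  have hm := Finset.ext_iff.mp h (a, t a)
  rw [mem_svType, mem_svType] at hm
  exact (hm.mp rfl).symm

/-- The tetrahedron of CM types (PerL l.60): `t¹=(+,+,+)`, `t²=(+,−,−)`, `t³=(+,−,+)`,
`t⁴=(+,+,−)`, with `true` = `+`. -/
def tet1 : Fin 3 → Bool := ![true, true, true]
/-- (no docstring in the 2001 source) -/
def tet2 : Fin 3 → Bool := ![true, false, false]
/-- (no docstring in the 2001 source) -/
def tet3 : Fin 3 → Bool := ![true, false, true]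
/-- (no docstring in the 2001 source) -/
def tet4 : Fin 3 → Bool := ![true, true, false]

/-- Smoke test (PerL rem:tetra at g = 3): the tetrahedron identity
`1_{Ψ₁}+1_{Ψ₂} = 1_{Ψ₃}+1_{Ψ₄}`, decided. -/
example : PairSum (svType tet1) (svType tet2) (svType tet3) (svType tet4) := by
  unfold PairSum
  decide

/-- Smoke test: the four tetrahedron types are pairwise distinct (PerL rem:tetra
l.213). -/
example : svType tet1 ≠ svType tet2 ∧ svType tet1 ≠ svType tet3 ∧
    svType tet1 ≠ svType tet4 ∧ svType tet2 ≠ svType tet3 ∧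
    svType tet2 ≠ svType tet4 ∧ svType tet3 ≠ svType tet4 := by decide

/-- Smoke test: all four contain the base embedding `φ₁ = (0, +)` (H2 at the
tetrahedron). -/
example : ((0 : Fin 3), true) ∈ svType tet1 ∧ ((0 : Fin 3), true) ∈ svType tet2 ∧
    ((0 : Fin 3), true) ∈ svType tet3 ∧ ((0 : Fin 3), true) ∈ svType tet4 := by decide

/-- Smoke test: the tetrahedron is (the Θ-normalisation of) a rank-four face (rfwf
ll.31-33): the corners of `(Φ_{t¹}; π₂, π₃)` are `Φ_{t¹}, cΦ_{t³}, cΦ_{t⁴}, Φ_{t²}`. -/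
example :
    corner2 (svIota 3) ((1 : Fin 3), true) (svType tet1)
        = conjS (svIota 3) (svType tet3) ∧
    corner3 (svIota 3) ((2 : Fin 3), true) (svType tet1)
        = conjS (svIota 3) (svType tet4) ∧
    corner4 (svIota 3) ((1 : Fin 3), true) ((2 : Fin 3), true) (svType tet1)
        = svType tet2 := by decide

/-- Smoke test, the g = 2 collapse (converse of distinctness): both places used ⇒
`Φ₄ = Φ̄₁` (rfwf l:tetra proof l.93-94). -/
example :
    corner4 (svIota 2) ((0 : Fin 2), true) ((1 : Fin 2), true)
      (svType ![true, true]) = conjS (svIota 2) (svType ![true, true]) := by decide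

end signVectors

end Perl34



end HodgeCM.Prior.Faces
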